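import Literature.Analysis.FluidPDE.KNSSTypeIRateLiouvilleDescent
import Literature.Analysis.FluidPDE.KNSSLiouvillePlanarHolds
import Literature.Analysis.FluidPDE.AncientMildWeak
import Literature.Analysis.FluidPDE.CurlFreeLiouville
import HarnessLib

/-!
# Stub `stub_translationLeaf` of the line `Ideator2Sketch` (card `flux-surface-persistence`)
# (crux `IsobaricLinesLiouville`, stmt-NavierStokesRegularity-11741, route `IsobarTomography`)

The PLANAR LEAF of the symmetric hull: a bounded ancient mild solution of Navier–Stokes
(`ν = 1`, duality form `IsBoundedAncientMildSolution`), classical on `(-∞, 0)`, whose vorticity is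
everywhere parallel to `e₁` (Lean coordinate `1`) at every `t < 0`, is constant on every slice.

Proof. Fix `t < 0` and write `V = v t`, `ω = curl V = (0, ω₁, 0)`.
* `ω₀ = 0`, `ω₂ = 0` read `∂₁V₂ = ∂₂V₁`, `∂₀V₁ = ∂₁V₀`; hence the gradient of the coordinate `V₁` is
  `∇V₁ = (∂₁V₀, ∂₁V₁, ∂₁V₂) = ∂₁V` and `ΔV₁ = ∂₁ (div V) = 0` (symmetry of second derivatives,
  `div V = 0`): `V₁` is a bounded harmonic function, hence constant (Liouville,
  `HarmonicOnNhd.apply_eq_apply_of_abs_le`), so `∂₁V = ∇V₁ = 0` and `V` is invariant under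
  `x ↦ x + δ e₁` (`apply_add_single_one_eq`).
* `v` is a bounded weak solution on `ℝ³ × (-∞, 0)`
  (`IsBoundedAncientMildSolution.isBoundedWeakNSSolutionOn`; measurability from joint smoothness),
  jointly continuous, `e₁`-invariant, with weakly divergence-free slices, so its planar trace
  `(v₀, v₂)(t, (y₀, 0, y₁))` is a bounded weak solution on `ℝ² × (-∞, 0)`
  (`IsBoundedWeakNSSolutionOn.planarTrace_of_lineInvariant`); KNSS 2009 Theorem 5.1
  (`KNSS2009_liouville_planar_holds`, proved in the tree) makes it `b(t)` a.e. for a.e. `t`, and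
  continuity upgrades this to `v₀(t, x) = v₀(t, 0)`, `v₂(t, x) = v₂(t, 0)` for every `t < 0`
  (`planar_const_of_ae_const`). With `V₁` constant, `v t x = v t 0`.

Physical space is `EuclideanSpace ℝ (Fin 3)` throughout, `eⱼ = EuclideanSpace.single j 1`.

## Contents

* `curl_apply_zero`, `curl_apply_two` — the coordinates `0`, `2` of `curl` (definitional).
* `laplacian_coord_one_eq_zero` — `ΔV₁ = 0` when `ω₀ = ω₂ = 0` and `div V = 0`.
* `coord_one_eq_of_bounded` — `V₁` is constant if moreover `V` is bounded.
* `fderiv_single_one_eq_zero`, `apply_add_single_one_eq` — `∂₁V = 0`, `V (x + δe₁) = V x`.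
* `stub_translationLeaf` — the registered stub.
-/

-- the summit and its single problem share the name (D-0017 nested layout)
set_option linter.dupNamespace false

noncomputable section

namespace Summit.NavierStokesRegularity.NavierStokesRegularity.Theorems.IsobaricLinesLiouville.FluxSurfacePersistence

open scoped InnerProductSpace RealInnerProductSpace ContDiff Laplacian
open Literature.Analysis.FluidPDE Set Function MeasureTheory WithLp InnerProductSpace
open EuclideanSpace (single)

/-! ## Vorticity along `e₁`: the coordinate `V₁` is harmonic, hence constant -/

/-- Coordinate `0` of the curl: `(curl V)₀ = ∂₁V₂ − ∂₂V₁` (definitional). -/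
theorem curl_apply_zero (V : EuclideanSpace ℝ (Fin 3) → EuclideanSpace ℝ (Fin 3))
    (x : EuclideanSpace ℝ (Fin 3)) :
    curl V x 0 = fderiv ℝ V x (single 1 1) 2 - fderiv ℝ V x (single 2 1) 1 := rfl

/-- Coordinate `2` of the curl: `(curl V)₂ = ∂₀V₁ − ∂₁V₀` (definitional). -/
theorem curl_apply_two (V : EuclideanSpace ℝ (Fin 3) → EuclideanSpace ℝ (Fin 3))
    (x : EuclideanSpace ℝ (Fin 3)) :
    curl V x 2 = fderiv ℝ V x (single 0 1) 1 - fderiv ℝ V x (single 1 1) 0 := rfl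

/-- **`V₁` is harmonic when `ω₀ = ω₂ = 0` and `div V = 0`.** For `V ∈ C²(ℝ³; ℝ³)` with
`(curl V)₀ = (curl V)₂ = 0` and `div V = 0`: `ΔV₁ = ∂₀∂₀V₁ + ∂₁∂₁V₁ + ∂₂∂₂V₁
= ∂₀∂₁V₀ + ∂₁∂₁V₁ + ∂₂∂₁V₂ = ∂₁(div V) = 0` (using `∂₀V₁ = ∂₁V₀`, `∂₂V₁ = ∂₁V₂` and the symmetry
of second derivatives). -/
theorem laplacian_coord_one_eq_zero {V : EuclideanSpace ℝ (Fin 3) → EuclideanSpace ℝ (Fin 3)}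
    (hV : ContDiff ℝ 2 V) (hω : ∀ x, curl V x 0 = 0 ∧ curl V x 2 = 0)
    (hdiv : VectorCalculus.IsDivFree V) (x : EuclideanSpace ℝ (Fin 3)) :
    (Δ (fun z => V z 1)) x = 0 := by
  set T := fderiv ℝ (fderiv ℝ V) x with hT
  -- (1) the two vanishing curl components, as identities of functions
  have h02 : (fun y => fderiv ℝ V y (single 1 1) 2) = fun y => fderiv ℝ V y (single 2 1) 1 :=
    funext fun y => sub_eq_zero.1 ((curl_apply_zero V y).symm.trans (hω y).1)
  have h20 : (fun y => fderiv ℝ V y (single 0 1) 1) = fun y => fderiv ℝ V y (single 1 1) 0 :=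
    funext fun y => sub_eq_zero.1 ((curl_apply_two V y).symm.trans (hω y).2)
  -- (2) differentiate them
  have hT02 : ∀ k, T k (single 1 1) 2 = T k (single 2 1) 1 := fun k => by
    rw [hT, ← fderiv_fderiv_apply_coord hV x (single 1 1) k 2,
      ← fderiv_fderiv_apply_coord hV x (single 2 1) k 1, h02]
  have hT20 : ∀ k, T k (single 0 1) 1 = T k (single 1 1) 0 := fun k => by
    rw [hT, ← fderiv_fderiv_apply_coord hV x (single 0 1) k 1,
      ← fderiv_fderiv_apply_coord hV x (single 1 1) k 0, h20]
  -- (3) symmetry of the second derivative in its two directions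
  have hT2 : ∀ h k, T h k = T k h := fun h k => (hV.contDiffAt.isSymmSndFDerivAt (by simp)) h k
  -- (4) the derivative of the divergence vanishes
  have hdiv' : ∀ k, ∑ j, T k (single j 1) j = 0 := by
    intro k
    have hzero : (fun y => ∑ j, fderiv ℝ V y (single j 1) j) = fun _ => (0 : ℝ) := by
      funext y
      have := hdiv y
      rw [VectorCalculus.divergence, trace_eq_sum_coord] at this
      exact this
    have h1 : fderiv ℝ (fun y => ∑ j, fderiv ℝ V y (single j 1) j) x k
        = ∑ j, T k (single j 1) j := by
      have hdj : ∀ j : Fin 3, DifferentiableAt ℝ (fun y => fderiv ℝ V y (single j 1) j) x := by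
        intro j
        have hd : DifferentiableAt ℝ (fderiv ℝ V) x :=
          ((hV.fderiv_right (m := 1) le_rfl).differentiable one_ne_zero) x
        have hdh : DifferentiableAt ℝ (fun y => fderiv ℝ V y (single j 1)) x :=
          hd.clm_apply (differentiableAt_const _)
        have e1 : (fun y => fderiv ℝ V y (single j 1) j) =
            (EuclideanSpace.proj j : EuclideanSpace ℝ (Fin 3) →L[ℝ] ℝ) ∘
              fun y => fderiv ℝ V y (single j 1) := by
          funext y; rfl
        rw [e1]
        exact (EuclideanSpace.proj j : EuclideanSpace ℝ (Fin 3) →L[ℝ] ℝ).differentiableAt.comp x hdh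
      rw [fderiv_fun_sum fun j _ => hdj j, _root_.sum_apply]
      exact Finset.sum_congr rfl fun j _ => fderiv_fderiv_apply_coord hV x _ _ j
    rw [← h1, hzero]
    simp
  -- (5) `ΔV₁ = (ΔV)₁ = Σⱼ (D²V eⱼ eⱼ)₁`
  have hΔ : (Δ V) x = ∑ j, T (single j 1) (single j 1) := by
    rw [laplacian_eq_sum_fderiv_fderiv (EuclideanSpace.basisFun (Fin 3) ℝ) hV x]
    refine Finset.sum_congr rfl fun j _ => ?_
    have hd : DifferentiableAt ℝ (fderiv ℝ V) x :=
      ((hV.fderiv_right (m := 1) le_rfl).differentiable one_ne_zero) x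
    simp only [EuclideanSpace.basisFun_apply]
    rw [fderiv_clm_apply hd (differentiableAt_const _)]
    simp [hT]
  have hηeq : (fun z => V z 1) =
      (EuclideanSpace.proj (1 : Fin 3) : EuclideanSpace ℝ (Fin 3) →L[ℝ] ℝ) ∘ V := by
    funext z; rfl
  rw [hηeq, hV.contDiffAt.laplacian_CLM_comp_left, Function.comp_apply, hΔ, map_sum,
    Fin.sum_univ_three]
  show T (single 0 1) (single 0 1) 1 + T (single 1 1) (single 1 1) 1
    + T (single 2 1) (single 2 1) 1 = 0
  rw [hT20 (single 0 1), hT2 (single 0 1) (single 1 1), ← hT02 (single 2 1),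
    hT2 (single 2 1) (single 1 1)]
  have h := hdiv' (single 1 1)
  rw [Fin.sum_univ_three] at h
  exact h

/-- **`V₁` is constant** for a bounded `C²` field on `ℝ³` with `(curl V)₀ = (curl V)₂ = 0` and
`div V = 0`: `V₁` is a bounded harmonic function (`laplacian_coord_one_eq_zero`), constant by
Liouville's theorem (`HarmonicOnNhd.apply_eq_apply_of_abs_le`). -/
theorem coord_one_eq_of_bounded {V : EuclideanSpace ℝ (Fin 3) → EuclideanSpace ℝ (Fin 3)}
    (hV : ContDiff ℝ 2 V) (hω : ∀ x, curl V x 0 = 0 ∧ curl V x 2 = 0)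
    (hdiv : VectorCalculus.IsDivFree V) {M : ℝ} (hM : ∀ x, ‖V x‖ ≤ M)
    (x y : EuclideanSpace ℝ (Fin 3)) : V x 1 = V y 1 := by
  set η : EuclideanSpace ℝ (Fin 3) → ℝ := fun z => V z 1 with hη
  have hηeq : η = (EuclideanSpace.proj (1 : Fin 3) : EuclideanSpace ℝ (Fin 3) →L[ℝ] ℝ) ∘ V := by
    funext z; rfl
  have hη2 : ContDiff ℝ 2 η := by
    rw [hηeq]
    exact (EuclideanSpace.proj (1 : Fin 3) : EuclideanSpace ℝ (Fin 3) →L[ℝ] ℝ).contDiff.comp hV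
  have hηΔ : ∀ z, (Δ η) z = 0 := fun z => laplacian_coord_one_eq_zero hV hω hdiv z
  have hharm : HarmonicOnNhd η univ := harmonicOnNhd_of_laplacian_eq_zero hη2 hηΔ
  have hbdd : ∀ z, |η z| ≤ M := fun z =>
    le_trans (by simpa [hη, Real.norm_eq_abs] using PiLp.norm_apply_le (V z) 1) (hM z)
  exact hharm.apply_eq_apply_of_abs_le hbdd x y

/-- **`∂₁V = 0`** for a bounded `C²` field on `ℝ³` with `(curl V)₀ = (curl V)₂ = 0` and
`div V = 0`: `∂₁V = (∂₁V₀, ∂₁V₁, ∂₁V₂) = (∂₀V₁, ∂₁V₁, ∂₂V₁) = ∇V₁ = 0` since `V₁` is constant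
(`coord_one_eq_of_bounded`). -/
theorem fderiv_single_one_eq_zero {V : EuclideanSpace ℝ (Fin 3) → EuclideanSpace ℝ (Fin 3)}
    (hV : ContDiff ℝ 2 V) (hω : ∀ x, curl V x 0 = 0 ∧ curl V x 2 = 0)
    (hdiv : VectorCalculus.IsDivFree V) {M : ℝ} (hM : ∀ x, ‖V x‖ ≤ M)
    (x : EuclideanSpace ℝ (Fin 3)) : fderiv ℝ V x (single 1 1) = 0 := by
  have hc : (fun z => V z 1) = fun _ => V 0 1 :=
    funext fun z => coord_one_eq_of_bounded hV hω hdiv hM z 0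
  -- every partial derivative of `V₁` vanishes
  have hD : ∀ h : EuclideanSpace ℝ (Fin 3), fderiv ℝ V x h 1 = 0 := by
    intro h
    have e1 : (fun z => V z 1) =
        (EuclideanSpace.proj (1 : Fin 3) : EuclideanSpace ℝ (Fin 3) →L[ℝ] ℝ) ∘ V := by
      funext z; rfl
    have e2 : fderiv ℝ (fun z => V z 1) x h = fderiv ℝ V x h 1 := by
      rw [e1, fderiv_comp x
        (EuclideanSpace.proj (1 : Fin 3) : EuclideanSpace ℝ (Fin 3) →L[ℝ] ℝ).differentiableAt
        ((hV.differentiable (by norm_num)) x), ContinuousLinearMap.fderiv,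
        ContinuousLinearMap.comp_apply]
      rfl
    rw [← e2, hc, fderiv_const_apply]
    rfl
  have h02 : fderiv ℝ V x (single 1 1) 2 = fderiv ℝ V x (single 2 1) 1 :=
    sub_eq_zero.1 ((curl_apply_zero V x).symm.trans (hω x).1)
  have h20 : fderiv ℝ V x (single 0 1) 1 = fderiv ℝ V x (single 1 1) 0 :=
    sub_eq_zero.1 ((curl_apply_two V x).symm.trans (hω x).2)
  have c0 : fderiv ℝ V x (single 1 1) 0 = 0 := by rw [← h20]; exact hD _
  have c1 : fderiv ℝ V x (single 1 1) 1 = 0 := hD _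
  have c2 : fderiv ℝ V x (single 1 1) 2 = 0 := by rw [h02]; exact hD _
  ext i
  fin_cases i
  · simpa using c0
  · simpa using c1
  · simpa using c2

/-- **Invariance along `e₁`**: a bounded `C²` field on `ℝ³` with `(curl V)₀ = (curl V)₂ = 0` and
`div V = 0` satisfies `V (x + δe₁) = V x` (the line `s ↦ V (x + s e₁)` has zero derivative,
`fderiv_single_one_eq_zero`, hence is constant, `is_const_of_deriv_eq_zero`). -/
theorem apply_add_single_one_eq {V : EuclideanSpace ℝ (Fin 3) → EuclideanSpace ℝ (Fin 3)}
    (hV : ContDiff ℝ 2 V) (hω : ∀ x, curl V x 0 = 0 ∧ curl V x 2 = 0)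
    (hdiv : VectorCalculus.IsDivFree V) {M : ℝ} (hM : ∀ x, ‖V x‖ ≤ M)
    (x : EuclideanSpace ℝ (Fin 3)) (δ : ℝ) : V (x + single 1 δ) = V x := by
  have hD := fderiv_single_one_eq_zero hV hω hdiv hM
  set γ : ℝ → EuclideanSpace ℝ (Fin 3) := fun s => V (x + s • single 1 1) with hγ
  have hd : ∀ s, HasDerivAt γ (0 : EuclideanSpace ℝ (Fin 3)) s := by
    intro s
    have hl : HasDerivAt (fun r : ℝ => x + r • (single 1 1 : EuclideanSpace ℝ (Fin 3)))
        (single 1 1) s := by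
      simpa using ((hasDerivAt_id s).smul_const (single 1 1 : EuclideanSpace ℝ (Fin 3))).const_add x
    have hVd : HasFDerivAt V (fderiv ℝ V (x + s • single 1 1)) (x + s • single 1 1) :=
      ((hV.differentiable (by norm_num)) _).hasFDerivAt
    have h := hVd.comp_hasDerivAt s hl
    rw [hD] at h
    exact h
  have hconst := is_const_of_deriv_eq_zero (fun s => (hd s).differentiableAt)
    (fun s => (hd s).deriv) δ 0
  have e : (single (1 : Fin 3) δ : EuclideanSpace ℝ (Fin 3)) = δ • single 1 1 := by
    ext i
    by_cases hi : i = 1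
    · subst hi; simp
    · simp [hi]
  rw [e]
  simpa [hγ] using hconst

/-! ## The registered stub -/

/-- **Planar leaf** (vorticity along one fixed direction ⟹ KNSS Thm 5.1): a bounded ancient mild
solution, classical on `(-∞,0)`, whose vorticity is everywhere parallel to `e₁` (Lean coordinate
`1`) at every `t < 0` is constant on every slice. Route: `(curl v)₀ = (curl v)₂ = 0` and
`div v = 0` make `v₁` a bounded harmonic function on each slice, hence constant, and then
`∂₁v = ∇v₁ = 0`, i.e. `v(t, ·)` is invariant under `x ↦ x + δe₁` (`apply_add_single_one_eq`);
`v` is a bounded weak solution on `ℝ³ × (-∞,0)`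
(`IsBoundedAncientMildSolution.isBoundedWeakNSSolutionOn`), so its planar trace is a bounded weak
solution on `ℝ² × (-∞,0)` (`IsBoundedWeakNSSolutionOn.planarTrace_of_lineInvariant`), which is
`b(t)` a.e. for a.e. `t` by `KNSS2009_liouville_planar_holds`; continuity upgrades a.e. to
everywhere (`planar_const_of_ae_const`). -/
theorem stub_translationLeaf :
    ∀ (v : ℝ → (EuclideanSpace ℝ (Fin 3)) → (EuclideanSpace ℝ (Fin 3))) (q : ℝ → (EuclideanSpace ℝ (Fin 3)) → ℝ),
      IsBoundedAncientMildSolution 1 v → IsClassicalNSSolutionOn (Set.Iio 0) 1 0 v q →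
        (∀ t < 0, ∀ x : (EuclideanSpace ℝ (Fin 3)), curl (v t) x 0 = 0 ∧ curl (v t) x 2 = 0) →
          ∀ t < 0, ∃ b : (EuclideanSpace ℝ (Fin 3)), v t = fun _ => b := by
  intro v q hanc hcl hω
  obtain ⟨C, hC⟩ := hanc.isBoundedOn
  have hcont : ContinuousOn (uncurry v) (Iio 0 ×ˢ univ) := hcl.smooth_velocity.continuousOn
  have hV2 : ∀ t < 0, ContDiff ℝ 2 (v t) := fun t ht =>
    contDiff_infty.1 (hcl.contDiff_velocity ht) 2
  -- the coordinate `1` is constant on every slice, and every slice is `e₁`-invariant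
  have h1 : ∀ t < 0, ∀ x, v t x 1 = v t 0 1 := fun t ht x =>
    coord_one_eq_of_bounded (hV2 t ht) (hω t ht) (hcl.divFree t ht) (fun y => hC t ht y) x 0
  have hinv : ∀ t ∈ Iio (0 : ℝ), ∀ (x : EuclideanSpace ℝ (Fin 3)) (δ : ℝ),
      v t (x + single 1 δ) = v t x := fun t ht x δ =>
    apply_add_single_one_eq (hV2 t ht) (hω t ht) (hcl.divFree t ht) (fun y => hC t ht y) x δ
  -- `v` is a bounded weak solution on `ℝ³ × (-∞, 0)`; descend to the plane
  have hmeas : AEStronglyMeasurable (uncurry v)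
      ((volume : Measure (ℝ × EuclideanSpace ℝ (Fin 3))).restrict (Iio 0 ×ˢ univ)) :=
    hcont.aestronglyMeasurable (measurableSet_Iio.prod MeasurableSet.univ)
  have hsl : ∀ t < 0, AEStronglyMeasurable (v t) volume := fun t ht =>
    (hV2 t ht).continuous.aestronglyMeasurable
  have hweak := hanc.isBoundedWeakNSSolutionOn one_pos hmeas hsl
  have hdivw : ∀ t ∈ Iio (0 : ℝ), IsWeaklyDivFree (v t) := fun t ht => hanc.1.1 t ht
  have hV := hweak.planarTrace_of_lineInvariant hcont hinv hdivw
  -- KNSS Theorem 5.1 on the plane, upgraded by continuity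
  obtain ⟨b, -, -, hae⟩ := KNSS2009_liouville_planar_holds hV
  have hpl := planar_const_of_ae_const hcont (fun t ht => hinv t ht) hae
  intro t ht
  refine ⟨v t 0, funext fun x => ?_⟩
  ext i
  fin_cases i
  · simpa using (hpl t ht x).1
  · simpa using h1 t ht x
  · simpa using (hpl t ht x).2

end Summit.NavierStokesRegularity.NavierStokesRegularity.Theorems.IsobaricLinesLiouville.FluxSurfacePersistence

end
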